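import Mathlib
import HarnessLib
import Summits.NavierStokesRegularity.NavierStokesRegularity.Theorems.TaylorModelRungThreeCertificateFrameNeumann
import Summits.NavierStokesRegularity.NavierStokesRegularity.Theorems.TaylorModelRungThreeCertificateIntervalDOps

/-!
# Crux K1b-DR (stmt-NavierStokesRegularity-23954), line `taylor-model` — v3 checker: the NODE STATE of the frame-absorbed
# vector step, the FRAME RULE (sqrt-free modified Gram–Schmidt + column pseudo-inverse) and the Neumann packaging
# (PROPAGATE-V-SPEC-cert1 rev. bcee1edc560e3a8a §1 «NODE STATE», §2 D; CERT-CONTRACT-23954 v3.1 §4 F-a/F-b; dss_60)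

Checker-internal objects of the successor engine-1's `FormatV` lane (no certificate record is imported; everything here is
generic array code over the kernel of `…IntervalDMatrix/…Bounds/…FrameNeumann`):

* small entrywise helpers with inclusion theorems: `subIMD` (interval − point), `addIM` (interval + interval), the
  containment test `subsetIM` (`memMat_of_subsetIM`), boxes `boxAround x r` (`memVec_boxAround`), the chosen midpoint
  matrix `midM`;
* `NodeSt` — the per-node state the checker carries inside a chunk (PROPAGATE-V-SPEC §1): point transport `Vc`, plain
  set-error radii `e`, error frame `B` with its approximate inverse `X`, Neumann constants `θ, φ` and the inverse
  enclosure `Ci := ciBox X φ`, centre radii `rp`, derivative error `Z`;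
* the FRAME RULE (a CHOSEN object — no inclusion claim, §2 D «any deterministic rounded rule»): `frameB n precB C` =
  two-pass sqrt-free modified Gram–Schmidt on the columns of `C` at `precB` mantissa bits, and `pinvCols n precB B` = the
  row-wise pseudo-inverse `q_cᵀ/⟨q_c,q_c⟩` of a matrix with near-orthogonal columns (works for the emitter's float QR frames
  at chunk starts as well); `neumannTheta`/`neumannPhi` (`θ` = rounded-up max row sum of `|I − X·B|`, `φ = θ + 2θ²`
  rounded up, which satisfies `θ + θφ ≤ φ` whenever `θ ≤ ½`);
* `mkNode` assembling a `NodeSt` from `(Vc, e, B, rp, Z)`, the node test `nodeOK` (Neumann test + `e, rp ≥ 0`) and its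
  soundness `exists_inv_of_nodeOK` (a real two-sided inverse of `dre B` inside `Ci`, from `exists_inv_of_checkInvFrame`).

MODEL-lattice bookkeeping only (rung TL-M3, one finite-dimensional model ODE); nothing here concerns the Navier–Stokes equations.
-/

-- the sub-problem namespace repeats the summit name by design (D-0017)
set_option linter.dupNamespace false

namespace Summit.NavierStokesRegularity.NavierStokesRegularity.Theorems.TaylorModelCert

open scoped BigOperators

/-! ### Entrywise helpers -/

section Helpers

/-- One row of `subIMD`. [folklore] -/
def subIMDRow (n prec : ℕ) (Mr : Array IntervalD) (Ar : Array Dyad) : Array IntervalD :=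
  Array.ofFn (n := n) fun c => IntervalD.subR prec (IntervalD.aget Mr c) (IntervalD.ofDyad (dget Ar c))

/-- Interval matrix minus point matrix, entrywise (rounded). [folklore] -/
def subIMD (n prec : ℕ) (M : Array (Array IntervalD)) (A : Array (Array Dyad)) : Array (Array IntervalD) :=
  Array.ofFn (n := n) fun r => subIMDRow n prec (rowOf M r) (rowOf A r)

/-- One row of `addIM`. [folklore] -/
def addIMRow (n prec : ℕ) (Mr Nr : Array IntervalD) : Array IntervalD :=
  Array.ofFn (n := n) fun c => IntervalD.addR prec (IntervalD.aget Mr c) (IntervalD.aget Nr c)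

/-- Entrywise sum of interval matrices (rounded). [folklore] -/
def addIM (n prec : ℕ) (M N : Array (Array IntervalD)) : Array (Array IntervalD) :=
  Array.ofFn (n := n) fun r => addIMRow n prec (rowOf M r) (rowOf N r)

/-- TEST `M ⊆ N` entrywise on `n × n`. [folklore] -/
def subsetIM (n : ℕ) (M N : Array (Array IntervalD)) : Bool :=
  allBelow (fun r => allBelow (fun c => IntervalD.subset (imget M r c) (imget N r c)) n) n

/-- The box `x ± r` as an interval vector. [folklore] -/
def boxAround (n : ℕ) (x r : Array Dyad) : Array IntervalD :=
  Array.ofFn (n := n) fun c => ⟨Dyad.sub (dget x c) (dget r c), Dyad.add (dget x c) (dget r c)⟩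

/-- Entrywise midpoint of an interval matrix (a chosen point matrix). [folklore] -/
def midM (n : ℕ) (M : Array (Array IntervalD)) : Array (Array Dyad) :=
  Array.ofFn (n := n) fun r =>
    let Mr := rowOf M r
    Array.ofFn (n := n) fun c => IntervalD.mid (IntervalD.aget Mr c)

variable {n : ℕ} (prec : ℕ)

/-- [folklore] -/
theorem memMat_subIMD {a : ℕ → ℕ → ℝ} {M : Array (Array IntervalD)} (ha : MemMat n a M) (A : Array (Array Dyad)) :
    MemMat n (fun r c => a r c - dre A r c) (subIMD n prec M A) := by
  intro r hr c hc
  simp only [subIMD, subIMDRow, imget_ofFn_row _ c hr, IntervalD.aget_ofFn _ hc]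
  exact IntervalD.mem_subR prec (ha r hr c hc) (IntervalD.mem_ofDyad _)

/-- [folklore] -/
theorem memMat_addIM {a b : ℕ → ℕ → ℝ} {M N : Array (Array IntervalD)} (ha : MemMat n a M) (hb : MemMat n b N) :
    MemMat n (fun r c => a r c + b r c) (addIM n prec M N) := by
  intro r hr c hc
  simp only [addIM, addIMRow, imget_ofFn_row _ c hr, IntervalD.aget_ofFn _ hc]
  exact IntervalD.mem_addR prec (ha r hr c hc) (hb r hr c hc)

/-- [folklore] -/
theorem memMat_of_subsetIM {a : ℕ → ℕ → ℝ} {M N : Array (Array IntervalD)} (h : subsetIM n M N = true)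
    (ha : MemMat n a M) : MemMat n a N := by
  intro r hr c hc
  have h1 := (allBelow_eq_true.1 ((allBelow_eq_true.1 h) r hr)) c hc
  exact IntervalD.mem_of_subset h1 (ha r hr c hc)

/-- [folklore] -/
theorem memVec_boxAround {v : ℕ → ℝ} {x r : Array Dyad} (h : ∀ c < n, |v c - vre x c| ≤ vre r c) :
    MemVec n v (boxAround n x r) := by
  intro c hc
  simp only [boxAround, IntervalD.aget_ofFn _ hc]
  have h' := abs_le.1 (h c hc)
  unfold vre at h'
  exact ⟨by simp only [Dyad.toReal_sub]; linarith [h'.1], by simp only [Dyad.toReal_add]; linarith [h'.2]⟩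

end Helpers

/-! ### The node state -/

/-- Checker-internal NODE STATE of the frame-absorbed vector step (PROPAGATE-V-SPEC §1). [folklore] -/
structure NodeSt where
  /-- point transport `Vc_s` -/
  Vc : Array (Array Dyad)
  /-- plain set-error radii `e_s ≥ 0` -/
  e : Array Dyad
  /-- error frame `B_s` (point) -/
  B : Array (Array Dyad)
  /-- approximate inverse of `B_s` -/
  X : Array (Array Dyad)
  /-- Neumann bound `‖I − X·B‖_∞ ≤ θ` -/
  θ : Dyad
  /-- Neumann widening `φ ≥ θ/(1−θ)` -/
  φ : Dyad
  /-- inverse enclosure `Ci = ciBox X φ ∋ B⁻¹` -/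
  Ci : Array (Array IntervalD)
  /-- centre-trajectory radii `rp_s ≥ 0` in the frame `B_s` -/
  rp : Array Dyad
  /-- derivative error `Z_s` in the frame `B_s` -/
  Z : Array (Array IntervalD)

/-! ### The frame rule (chosen objects; no inclusion claims) -/

section Frame

/-- Rounded-down dot product `Σ_{t<k} u[t]·v[t]` (chosen). [folklore] -/
def dotDnV (prec : ℕ) (u v : Array Dyad) : ℕ → Dyad
  | 0 => Dyad.zero
  | t + 1 => Dyad.roundDown prec (Dyad.add (dotDnV prec u v t) (Dyad.mul (dget u t) (dget v t)))

/-- `v − a·u`, rounded down entrywise (chosen). [folklore] -/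
def axmyD (n prec : ℕ) (a : Dyad) (u v : Array Dyad) : Array Dyad :=
  Array.ofFn (n := n) fun i => Dyad.roundDown prec (Dyad.sub (dget v i) (Dyad.mul a (dget u i)))

/-- One Gram–Schmidt sweep: subtract from `q` its (rounded) components along `qs[0..k)`. [folklore] -/
def orthoAgainst (n prec : ℕ) (qs : Array (Array Dyad)) (nn : Array Dyad) (q : Array Dyad) : ℕ → Array Dyad
  | 0 => q
  | d + 1 =>
    let q' := orthoAgainst n prec qs nn q d
    let qd := rowOf qs d
    axmyD n prec (Dyad.divApprox prec (dotDnV prec q' qd n) (dget nn d)) qd q'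

/-- Two-pass sqrt-free MGS over the first `k` columns: returns the orthogonalised columns and their squared norms.
[folklore] -/
def mgsLoop (n prec : ℕ) (cols : Array (Array Dyad)) : ℕ → Array (Array Dyad) × Array Dyad
  | 0 => (#[], #[])
  | c + 1 =>
    let prev := mgsLoop n prec cols c
    let q₁ := orthoAgainst n prec prev.1 prev.2 (rowOf cols c) c
    let q₂ := orthoAgainst n prec prev.1 prev.2 q₁ c
    (prev.1.push q₂, prev.2.push (dotDnV prec q₂ q₂ n))

/-- **The frame rule**: near-orthogonal columns spanning (approximately) the columns of `C`. [folklore] -/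
def frameB (n precB : ℕ) (C : Array (Array Dyad)) : Array (Array Dyad) :=
  transposeD n (mgsLoop n precB (transposeD n C) n).1

/-- Row-wise pseudo-inverse `X[c] := B_cᵀ/⟨B_c, B_c⟩` of a matrix with near-orthogonal columns (chosen). [folklore] -/
def pinvCols (n precB : ℕ) (B : Array (Array Dyad)) : Array (Array Dyad) :=
  let cols := transposeD n B
  Array.ofFn (n := n) fun c =>
    let qc := rowOf cols c
    let nc := dotDnV precB qc qc n
    Array.ofFn (n := n) fun r => Dyad.divApprox precB (dget qc r) nc

/-- `max_{r<k}` of the upward row sums of magnitudes of `E` (rounded up to 16 bits). [folklore] -/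
def maxRowMag (n prec : ℕ) (E : Array (Array IntervalD)) : ℕ → Dyad
  | 0 => Dyad.zero
  | r + 1 => Dyad.max (maxRowMag n prec E r) (Dyad.roundUp 16 (rowMagUp prec (rowOf E r) n))

/-- Neumann `θ ≥ ‖I − X·B‖_∞` (chosen upper bound; the TEST re-verifies it). [folklore] -/
def neumannTheta (n prec : ℕ) (X B : Array (Array Dyad)) : Dyad := maxRowMag n prec (oneSubMulDD n prec X B) n

/-- Neumann `φ := θ + 2θ²` rounded up (satisfies `θ + θφ ≤ φ` whenever `θ ≤ ½`). [folklore] -/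
def neumannPhi (θ : Dyad) : Dyad := Dyad.roundUp 16 (Dyad.add θ (Dyad.shift (Dyad.mul θ θ) 1))

end Frame

/-! ### Assembling and testing a node state -/

section Node

/-- Assemble a node state from `(Vc, e, B, rp, Z)`: approximate inverse, Neumann constants, inverse enclosure. [folklore] -/
def mkNode (n prec precB : ℕ) (Vc : Array (Array Dyad)) (e : Array Dyad) (B : Array (Array Dyad)) (rp : Array Dyad)
    (Z : Array (Array IntervalD)) : NodeSt :=
  let X := pinvCols n precB B
  let θ := neumannTheta n prec X B
  let φ := neumannPhi θ
  { Vc := Vc, e := e, B := B, X := X, θ := θ, φ := φ, Ci := ciBox n X φ, rp := rp, Z := Z }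

/-- NODE TEST: the Neumann frame-inverse test, consistency of `Ci`, and `e, rp ≥ 0`. [folklore] -/
def nodeOK (n prec : ℕ) (N : NodeSt) : Bool :=
  checkInvFrame n prec N.X N.B N.θ N.φ && decide (N.Ci = ciBox n N.X N.φ) && nonnegVec n N.e && nonnegVec n N.rp

variable {n : ℕ} (prec : ℕ)

/-- **Soundness of the node test**: a real two-sided inverse of `dre B` lies in `N.Ci`, and `e, rp ≥ 0`. [folklore] -/
theorem exists_inv_of_nodeOK {N : NodeSt} (h : nodeOK n prec N = true) :
    (∃ g : ℕ → ℕ → ℝ,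
      (∀ r < n, ∀ c < n, ∑ t ∈ Finset.range n, dre N.B r t * g t c = if r = c then 1 else 0) ∧
      (∀ r < n, ∀ c < n, ∑ t ∈ Finset.range n, g r t * dre N.B t c = if r = c then 1 else 0) ∧
      MemMat n g N.Ci) ∧
    (∀ c < n, 0 ≤ vre N.e c) ∧ (∀ c < n, 0 ≤ vre N.rp c) := by
  simp only [nodeOK, Bool.and_eq_true, decide_eq_true_eq] at h
  obtain ⟨⟨⟨hinv, hCi⟩, he⟩, hrp⟩ := h
  obtain ⟨g, h1, h2, h3⟩ := exists_inv_of_checkInvFrame prec hinv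
  rw [← hCi] at h3
  exact ⟨⟨g, h1, h2, h3⟩, fun c hc => nonneg_of_nonnegVec he hc, fun c hc => nonneg_of_nonnegVec hrp hc⟩

end Node

end Summit.NavierStokesRegularity.NavierStokesRegularity.Theorems.TaylorModelCert
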